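import Summits.KontsevichZagierPeriods.Zeta5Search.RVFlatGaugeCapCore
import HarnessLib.Audit
import HarnessLib

/-!
# RVFlatGaugeCap — the FLAT `S₇`-gauge law with LARGE lower parameters, PROVED on the whole reach of the class-law route (fam-rv gen 8, file 3/4)

HONEST FRAMING: systematic search; no irrationality claim unless certified.  This file PROVES strict enlargements of
fam-rv gen-7's THEOREM W (`Zeta5Search/RVFlatGaugeWindow.lean`, `flatGaugeLaw_of_window`): the conjectural flat
`S₇`-gauge law (`RVFlatGauge.FlatGaugeLaw` / `FlatGaugeLaw28`, Brown–Zudilin arXiv:2210.03391 §9 (28)–(30) for all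
5040 labellings of the lower parameters) beyond the hypothesis "all seven lower parameters `< p`".  No γ / measure
claim; nothing minted by this cell is used as a hypothesis; conjecture nodes stay conjectures.

SETTING.  `b` in the Brown–Zudilin polytope, `1 ≤ j ≤ 7` with `b + e_j` in the polytope, `p ≥ 5` prime, and
  (W3) at most ONE block `b₀ − 2b_k` is `≥ p`.            Write `nbig := #{k : b_k ≥ p}`, `d = 3b₀ − Σ b_k`.
THEOREM W⁺ (CAP) (`flatGaugeLaw_of_cap`; (28) alone `flatGaugeLaw28_of_cap`).  If  `nbig + [2p ≤ d] ≤ 3`  then for EVERY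
  `σ ∈ S₇`:  `v_p C_j(b) ≥ −e_D♭(b,p) − v_p ρ(σ•b)`.  (Gen-7's THEOREM W is the case `nbig = 0`; its window hypothesis
  `b₀ + 2 < p²` is automatic here, since one long block and `nbig ≤ 5` force `b₀ < 3p`.)
THEOREM W⁺ (DISJ) (`flatGaugeLaw_of_disjoint`; `flatGaugeLaw28_of_disjoint`).  If `b₀ < 3p`, `d < 2p` and NO lower parameter
  `≥ p` is a partner in a pair form `≥ p` (`b_k ≥ p ⇒ b₀ − b_j − b_k < p` for all `j ≠ k`), the same conclusion holds —
  e.g. for ALL SEVEN `b_k ≥ p` (`b = (12;5,5,5,5,5,5,5)`, `p = 5`) or `b = (10;5,5,5,5,4,4,1)`, `p = 5` (`nbig = 4`).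

PROOF (all in Lean).  Route unchanged: FLAT ≤ (CV) ≤ truth, (CV) being the tree's PROVED class law
`ClusterValuation.casoratianLaw_of_noMultipole` (needs only `b₀ + 2 < p²` and (W3)).  The inequality FLAT ≤ (CV) is the
unit budget `Cap.flatBudget` of `RVFlatGaugeCapCore.lean`: charged `a ≤ 2` non-`E` pair floors + `denSum ≤ nden ≤ nbig`
denominator floors + `[2p ≤ d]`; paid `T ≥ min(4, a + nbig)` + `L ≥ [a + nbig ≥ 5 ∨ 2p ≤ d]`.  (CAP) closes it by
counting; (DISJ) closes it by the path structure of the non-`E` pairs (`a + nden ≤ 5`, `Cap.path_budget`).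

SHARPNESS / HONEST LIMITS (exact arithmetic, in-seat; `pub-zeta5-fam-rv/gen8/rv8_maxcost.py`, `rv8_cap.py`, `rv8_lbflat.py`).
(CAP) ∨ (DISJ ∧ d < 2p) is, for `b₀ < 3p`, the COMPLETE reach of the class-law route: the comparison "best flat gauge
`−e_D♭ − min_σ v_p ρ(σ•b)` ≤ (CV)" is an explicit `S₇`-invariant unit count, and on the region (W3), exhaustive `b₀ ≤ 22`
(52,342 instances `(b,p)`, `p ≤ m₁`; 45,859 in gen-7's window, 6,483 BEYOND it) it holds in exactly 3,468 beyond-window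
instances, of which 3,289 have `b₀ < 3p` — and (CAP) ∨ (DISJ ∧ d<2p) holds in exactly those 3,289 ((CAP): 2,650; newly by
(DISJ): 639 = the classes `nbig = 4, P ≤ 2`, `nbig = 5, P ≤ 1`, `nbig ∈ {6,7}, P = 0`, `P` = #pair forms `≥ p`); random
`b₀ ≤ 96` (20,000 vectors, 15,779 instances, 917 beyond the window): 696 comparisons hold, 692 with `b₀ < 3p`, all 692
covered, 0 exceptions.  On 3,015 beyond-window instances (`b₀ ≤ 22`; random: 221) the (CV) route is DEAD (flat gauge
> cv) and FLAT — still OBSERVED (0 violations against the exact `v_p C_j` in 79,490 instances `b₀ ≤ 14` and the lane's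
698,554) — is NOT proved there, nor in zone C (≥ 2 long blocks); the 179 (random: 4) comparisons that hold with `b₀ ≥ 3p`
(`nbig ≥ 6`, `P = 0`) are outside both hypotheses (second `p`-adic digit of `b₀`).  The casLB route
(`CasoratianClassBound`) gives no clean theorem either (casLB < flat gauge in 81/1,638 resp. 949/7,256 deep
beyond-window rows, `b₀ ≤ 14` resp. `15..20`).

VALUE (numbers, not adjectives).  γ: 0.000 — the record ray `n·(41;17,…,11)` has its one-long-block primes in
`(17n,18n]`, inside gen-7's window; the proved exponent stays `γ = 0.85488` (Brown–Zudilin `0.86597135` conditional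
on the OBSERVED laws).  Structural (T1/T3): (28)–(30)-for-all-labellings is now a THEOREM wherever the `S₇` accounting
can be compared with the class law by units — with up to seven lower parameters `≥ p`.
-/

namespace Summit.KontsevichZagierPeriods.Zeta5Search.RVFlatGauge

open Finset
open Summit.KontsevichZagierPeriods.Zeta5Search.CasoratianValuation (casoratian shift InPolytope pairFloors refund)
open Summit.KontsevichZagierPeriods.Zeta5Search.WedgeDictionary (dOf Epairs)
open Summit.KontsevichZagierPeriods.Zeta5Search.SymmetricGauge
open Summit.KontsevichZagierPeriods.Zeta5Search.DualSeries (InBox)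
open Window

namespace Cap
/-! ### Closing the budget: LEMMA A⁺ in the two regimes -/

/-- `b₀ < 3p` and `p ≥ 5` give gen-7's window hypothesis `b₀ + 2 < p²`. -/
theorem win_of_lt_three_p {c : ℕ → ℤ} {p : ℕ} (hp5 : 5 ≤ p) (hc3 : c 0 < 3 * (p : ℤ)) :
    (c 0 + 2 : ℤ) < (p : ℤ) ^ 2 := by
  have hp5' : (5 : ℤ) ≤ p := by exact_mod_cast hp5
  nlinarith

/-- **LEMMA A⁺ (CAP).**  One long block and `#{k : c_k ≥ p} + [2p ≤ d] ≤ 3` ⇒ flat `S₇`-gauge bound ≤ class-law bound: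
`−e_D♭(c) − v_p ρ(c) ≤ refund − N_p(c)`. -/
theorem gauge_le_cv_of_cap (c : ℕ → ℤ) {p : ℕ} (hc : InPolytope c) (hp : p.Prime) (hp5 : 5 ≤ p) {i : ℕ}
    (hshort : ∀ k ∈ (range 7).erase i, c 0 - 2 * c (k + 1) < p)
    (hcap : (nbig c p : ℤ) + (if 2 * (p : ℤ) ≤ dOf c then 1 else 0) ≤ 3) :
    -eDflat c p - padicValRat p (rhoB c) ≤ refund c p - pairFloors c p := by
  have hp0 : (0 : ℤ) < p := by exact_mod_cast hp.pos
  have hind : (0 : ℤ) ≤ (if 2 * (p : ℤ) ≤ dOf c then 1 else 0) := by split_ifs <;> norm_num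
  have hn3 : (nbig c p : ℤ) ≤ 3 := by linarith
  have h5 : nbig c p ≤ 5 := by exact_mod_cast (show (nbig c p : ℤ) ≤ 5 by linarith)
  have hc3 := b0_lt_three_p hshort h5
  obtain ⟨a, T, L, ha0, ha2, hnon, hden, hnden, hT, hL5, hL2, hL0, hflat, hval, hpf, hrefund, ht0, ht2, -⟩ :=
    flatBudget c hc hp hp5 (win_of_lt_three_p hp5 hc3) hshort hc3
  rw [hflat, hval, hrefund, hpf]
  by_cases h2p : 2 * (p : ℤ) ≤ dOf c
  · -- `⌊d/p⌋ = 2`: refund `1`, the fifth modulus pays `1`; `nbig ≤ 2`, so `a + nbig ≤ 4 ≤ T`-capacity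
    rw [if_pos h2p] at hcap
    have htd : dOf c / (p : ℤ) = 2 := by
      have := (Int.le_ediv_iff_mul_le hp0).2 (show 2 * (p : ℤ) ≤ dOf c from h2p)
      omega
    have hL := hL2 h2p
    have hT' : a + (nbig c p : ℤ) ≤ T := by rw [min_eq_right (by linarith)] at hT; exact hT
    rw [htd, min_eq_left (by norm_num : (1 : ℤ) ≤ 2)]
    linarith
  · -- `⌊d/p⌋ ≤ 1` is refunded; `nbig ≤ 3`; either `a + nbig ≤ 4 ≤ T`-capacity or `a + nbig = 5 = 4 + 1`
    rw [if_neg h2p] at hcap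
    have ht1 : dOf c / (p : ℤ) ≤ 1 := by
      have := (Int.ediv_lt_iff_lt_mul hp0).2 (show dOf c < 2 * (p : ℤ) by omega)
      omega
    rw [min_eq_right ht1]
    by_cases h4 : a + (nbig c p : ℤ) ≤ 4
    · have hT' : a + (nbig c p : ℤ) ≤ T := by rw [min_eq_right h4] at hT; exact hT
      linarith
    · have hT' : (4 : ℤ) ≤ T := by rw [min_eq_left (by linarith)] at hT; exact hT
      have hL := hL5 (by linarith)
      linarith

/-- **LEMMA A⁺ (DISJ).**  One long block, `c₀ < 3p`, `d < 2p`, and no large lower parameter is a partner in a large pair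
form ⇒ flat `S₇`-gauge bound ≤ class-law bound. -/
theorem gauge_le_cv_of_disjoint (c : ℕ → ℤ) {p : ℕ} (hc : InPolytope c) (hp : p.Prime) (hp5 : 5 ≤ p) {i : ℕ}
    (hshort : ∀ k ∈ (range 7).erase i, c 0 - 2 * c (k + 1) < p) (hc3 : c 0 < 3 * (p : ℤ))
    (hd : dOf c < 2 * (p : ℤ))
    (hdisj : ∀ j ∈ range 7, ∀ k ∈ range 7, j ≠ k → (p : ℤ) ≤ c (k + 1) → c 0 - c (j + 1) - c (k + 1) < p) :
    -eDflat c p - padicValRat p (rhoB c) ≤ refund c p - pairFloors c p := by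
  have hp0 : (0 : ℤ) < p := by exact_mod_cast hp.pos
  obtain ⟨a, T, L, ha0, ha2, hnon, hden, hnden, hT, hL5, -, hL0, hflat, hval, hpf, hrefund, ht0, -, hpath⟩ :=
    flatBudget c hc hp hp5 (win_of_lt_three_p hp5 hc3) hshort hc3
  have h5 := hpath hdisj
  rw [hflat, hval, hrefund, hpf]
  have ht1 : dOf c / (p : ℤ) ≤ 1 := by
    have := (Int.ediv_lt_iff_lt_mul hp0).2 hd
    omega
  rw [min_eq_right ht1]
  by_cases h4 : a + (nbig c p : ℤ) ≤ 4
  · have hT' : a + (nbig c p : ℤ) ≤ T := by rw [min_eq_right h4] at hT; exact hT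
    linarith
  · -- five units available (`T ≥ 4`, `L ≥ 1`); the path budget caps the charge at `a + nden ≤ 5`
    have hT' : (4 : ℤ) ≤ T := by rw [min_eq_left (by linarith)] at hT; exact hT
    have hL := hL5 (by linarith)
    linarith

/-- Transport of a (28)-type law along `σ ∈ S₇`: if `−e_D♭ − v_p ρ ≤ v_p C_{j'}` holds for `σ•b` in every admissible
direction `j'`, it holds for `b` with `ρ(σ•b)` (`C_j` and `e_D♭` are `S₇`-invariant: `casoratianPermSymmetry_holds`,
`eDflat_permLower`). -/
theorem flat_of_perm28 (b : ℕ → ℤ) {j p : ℕ} (σ : Equiv.Perm (Fin 7)) (hj1 : 1 ≤ j) (hj7 : j ≤ 7)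
    (hb' : InPolytope (shift b j)) (hcas : casoratian b j ≠ 0)
    (h28 : ∀ j', 1 ≤ j' → j' ≤ 7 → InPolytope (shift (permLower σ b) j') → casoratian (permLower σ b) j' ≠ 0 →
      -eDflat (permLower σ b) p - padicValRat p (rhoB (permLower σ b)) ≤
        padicValRat p (casoratian (permLower σ b) j')) :
    -eDflat b p - padicValRat p (rhoB (permLower σ b)) ≤ padicValRat p (casoratian b j) := by
  set i₀ : Fin 7 := σ.symm ⟨j - 1, by omega⟩ with hi₀
  have hσi : (σ i₀).val + 1 = j := by simp [hi₀]; omega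
  have hcas' : casoratian (permLower σ b) (i₀.val + 1) = casoratian b j := by
    rw [casoratianPermSymmetry_holds b σ i₀, hσi]
  have hshift : InPolytope (shift (permLower σ b) (i₀.val + 1)) := by
    rw [shift_permLower, hσi]; exact inPolytope_permLower σ hb'
  have hne : casoratian (permLower σ b) (i₀.val + 1) ≠ 0 := by rw [hcas']; exact hcas
  have key := h28 (i₀.val + 1) (by omega) (by have := i₀.isLt; omega) hshift hne
  rw [hcas', eDflat_permLower] at key
  exact key

/-- (W3) is `S₇`-invariant: the long block of `σ•b` sits at `σ⁻¹(i)`. -/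
theorem short_permLower (σ : Equiv.Perm (Fin 7)) {b : ℕ → ℤ} {p : ℕ} {i : ℕ}
    (hshort : ∀ k ∈ (range 7).erase i, b 0 - 2 * b (k + 1) < (p : ℤ)) :
    ∃ i' : ℕ, ∀ k ∈ (range 7).erase i', permLower σ b 0 - 2 * permLower σ b (k + 1) < (p : ℤ) := by
  obtain ⟨i, hi7, hblk⟩ : ∃ i', i' < 7 ∧ ∀ k, k < 7 → k ≠ i' → b 0 - 2 * b (k + 1) < (p : ℤ) := by
    by_cases hi : i < 7
    · exact ⟨i, hi, fun k hk hki => hshort k (mem_erase.2 ⟨hki, mem_range.2 hk⟩)⟩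
    · exact ⟨0, by norm_num, fun k hk _ => hshort k (mem_erase.2 ⟨by omega, mem_range.2 hk⟩)⟩
  refine ⟨(σ.symm ⟨i, hi7⟩).val, fun k hk => ?_⟩
  obtain ⟨hki, hk'⟩ := mem_erase.1 hk
  have hk7 := mem_range.1 hk'
  have happ := permLower_apply_succ σ b ⟨k, hk7⟩
  simp only at happ
  rw [permLower_zero, happ]
  refine hblk _ (σ ⟨k, hk7⟩).isLt fun heq => hki ?_
  have hσk : σ ⟨k, hk7⟩ = ⟨i, hi7⟩ := Fin.ext heq
  have := congrArg σ.symm hσk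
  rw [Equiv.symm_apply_apply] at this
  rw [← this]

end Cap

open Cap

/-! ### The theorems -/

/-- **THEOREM W⁺-28 (CAP): the FLAT law (28), PROVED** for `b` in the polytope, an admissible direction `e_j`, a prime
`p ≥ 5`, at most one long block, and `#{k : b_k ≥ p} + [2p ≤ d] ≤ 3`:  `−e_D♭(b,p) − v_p ρ(b) ≤ v_p C_j(b)`
(= LEMMA A⁺ (CAP) + the tree's `casoratianLaw_of_noMultipole`). -/
theorem flatGaugeLaw28_of_cap (b : ℕ → ℤ) {j p : ℕ} (hb : InPolytope b) (hj1 : 1 ≤ j) (hj7 : j ≤ 7)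
    (hb' : InPolytope (shift b j)) (hp : p.Prime) (hp5 : 5 ≤ p)
    {i : ℕ} (hshort : ∀ k ∈ (range 7).erase i, b 0 - 2 * b (k + 1) < p)
    (hcap : (nbig b p : ℤ) + (if 2 * (p : ℤ) ≤ dOf b then 1 else 0) ≤ 3) (hcas : casoratian b j ≠ 0) :
    -eDflat b p - padicValRat p (rhoB b) ≤ padicValRat p (casoratian b j) := by
  haveI : Fact p.Prime := ⟨hp⟩
  have hind : (0 : ℤ) ≤ (if 2 * (p : ℤ) ≤ dOf b then 1 else 0) := by split_ifs <;> norm_num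
  have h5 : nbig b p ≤ 5 := by exact_mod_cast (show (nbig b p : ℤ) ≤ 5 by linarith)
  have hwin := win_of_lt_three_p hp5 (b0_lt_three_p hshort h5)
  exact (gauge_le_cv_of_cap b hb hp hp5 hshort hcap).trans
    (ClusterValuation.casoratianLaw_of_noMultipole b hb hj1 hj7 hb' hp5 hwin
      (fun x _ => ClusterValuation.classPoleCount_le_one_of_short_blocks b hb hp.pos hshort x) hcas)

/-- **THEOREM W⁺-28 (DISJ): the FLAT law (28), PROVED** for `b` in the polytope, an admissible direction `e_j`, a prime
`p ≥ 5` with `b₀ < 3p` and `d < 2p`, at most one long block, and no lower parameter `≥ p` a partner in a pair form `≥ p`. -/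
theorem flatGaugeLaw28_of_disjoint (b : ℕ → ℤ) {j p : ℕ} (hb : InPolytope b) (hj1 : 1 ≤ j) (hj7 : j ≤ 7)
    (hb' : InPolytope (shift b j)) (hp : p.Prime) (hp5 : 5 ≤ p)
    {i : ℕ} (hshort : ∀ k ∈ (range 7).erase i, b 0 - 2 * b (k + 1) < p) (hb3 : b 0 < 3 * (p : ℤ))
    (hd : dOf b < 2 * (p : ℤ))
    (hdisj : ∀ j' ∈ range 7, ∀ k ∈ range 7, j' ≠ k → (p : ℤ) ≤ b (k + 1) → b 0 - b (j' + 1) - b (k + 1) < p)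
    (hcas : casoratian b j ≠ 0) :
    -eDflat b p - padicValRat p (rhoB b) ≤ padicValRat p (casoratian b j) := by
  haveI : Fact p.Prime := ⟨hp⟩
  exact (gauge_le_cv_of_disjoint b hb hp hp5 hshort hb3 hd hdisj).trans
    (ClusterValuation.casoratianLaw_of_noMultipole b hb hj1 hj7 hb' hp5 (win_of_lt_three_p hp5 hb3)
      (fun x _ => ClusterValuation.classPoleCount_le_one_of_short_blocks b hb hp.pos hshort x) hcas)

/-- **THEOREM W⁺ (CAP): the FLAT `S₇`-gauge law for ALL 5040 labellings, PROVED** on the capacity region — the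
hypotheses are `S₇`-invariant (`Cap.nbig_permLower`, `Cap.short_permLower`, `d` by `gaugeDataPermInvariant_holds`), so
W⁺-28 is transported along `σ` (`Cap.flat_of_perm28`). -/
theorem flatGaugeLaw_of_cap (b : ℕ → ℤ) {j p : ℕ} (σ : Equiv.Perm (Fin 7)) (hb : InPolytope b)
    (hj1 : 1 ≤ j) (hj7 : j ≤ 7) (hb' : InPolytope (shift b j)) (hp : p.Prime) (hp5 : 5 ≤ p)
    {i : ℕ} (hshort : ∀ k ∈ (range 7).erase i, b 0 - 2 * b (k + 1) < p)
    (hcap : (nbig b p : ℤ) + (if 2 * (p : ℤ) ≤ dOf b then 1 else 0) ≤ 3) (hcas : casoratian b j ≠ 0) :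
    -eDflat b p - padicValRat p (rhoB (permLower σ b)) ≤ padicValRat p (casoratian b j) := by
  obtain ⟨i', hshort'⟩ := short_permLower σ hshort
  have hcap' : (nbig (permLower σ b) p : ℤ) + (if 2 * (p : ℤ) ≤ dOf (permLower σ b) then 1 else 0) ≤ 3 := by
    rw [nbig_permLower, (gaugeDataPermInvariant_holds b σ).2.1]; exact hcap
  exact flat_of_perm28 b σ hj1 hj7 hb' hcas fun j' hj1' hj7' hshift hne =>
    flatGaugeLaw28_of_cap (permLower σ b) (inPolytope_permLower σ hb) hj1' hj7' hshift hp hp5 hshort' hcap' hne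

/-- **THEOREM W⁺ (DISJ): the FLAT `S₇`-gauge law for ALL 5040 labellings, PROVED** on the disjoint region
(`Cap.disj_permLower`: (DISJ) is `S₇`-invariant; `b₀`, `d` are invariant). -/
theorem flatGaugeLaw_of_disjoint (b : ℕ → ℤ) {j p : ℕ} (σ : Equiv.Perm (Fin 7)) (hb : InPolytope b)
    (hj1 : 1 ≤ j) (hj7 : j ≤ 7) (hb' : InPolytope (shift b j)) (hp : p.Prime) (hp5 : 5 ≤ p)
    {i : ℕ} (hshort : ∀ k ∈ (range 7).erase i, b 0 - 2 * b (k + 1) < p) (hb3 : b 0 < 3 * (p : ℤ))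
    (hd : dOf b < 2 * (p : ℤ))
    (hdisj : ∀ j' ∈ range 7, ∀ k ∈ range 7, j' ≠ k → (p : ℤ) ≤ b (k + 1) → b 0 - b (j' + 1) - b (k + 1) < p)
    (hcas : casoratian b j ≠ 0) :
    -eDflat b p - padicValRat p (rhoB (permLower σ b)) ≤ padicValRat p (casoratian b j) := by
  obtain ⟨i', hshort'⟩ := short_permLower σ hshort
  have hb3' : permLower σ b 0 < 3 * (p : ℤ) := by rw [permLower_zero]; exact hb3
  have hd' : dOf (permLower σ b) < 2 * (p : ℤ) := by rw [(gaugeDataPermInvariant_holds b σ).2.1]; exact hd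
  exact flat_of_perm28 b σ hj1 hj7 hb' hcas fun j' hj1' hj7' hshift hne =>
    flatGaugeLaw28_of_disjoint (permLower σ b) (inPolytope_permLower σ hb) hj1' hj7' hshift hp hp5 hshort' hb3' hd'
      (disj_permLower σ hdisj) hne

/-- **Corollary: at most TWO large lower parameters** (`nbig ≤ 2`, any `d`). -/
theorem flatGaugeLaw_of_nbig_le_two (b : ℕ → ℤ) {j p : ℕ} (σ : Equiv.Perm (Fin 7)) (hb : InPolytope b)
    (hj1 : 1 ≤ j) (hj7 : j ≤ 7) (hb' : InPolytope (shift b j)) (hp : p.Prime) (hp5 : 5 ≤ p)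
    {i : ℕ} (hshort : ∀ k ∈ (range 7).erase i, b 0 - 2 * b (k + 1) < p)
    (h2 : nbig b p ≤ 2) (hcas : casoratian b j ≠ 0) :
    -eDflat b p - padicValRat p (rhoB (permLower σ b)) ≤ padicValRat p (casoratian b j) := by
  refine flatGaugeLaw_of_cap b σ hb hj1 hj7 hb' hp hp5 hshort ?_ hcas
  have h : (if 2 * (p : ℤ) ≤ dOf b then (1 : ℤ) else 0) ≤ 1 := by split_ifs <;> norm_num
  have : (nbig b p : ℤ) ≤ 2 := by exact_mod_cast h2
  linarith

/-- **Corollary: three large lower parameters and `d < 2p`.** -/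
theorem flatGaugeLaw_of_nbig_le_three (b : ℕ → ℤ) {j p : ℕ} (σ : Equiv.Perm (Fin 7)) (hb : InPolytope b)
    (hj1 : 1 ≤ j) (hj7 : j ≤ 7) (hb' : InPolytope (shift b j)) (hp : p.Prime) (hp5 : 5 ≤ p)
    {i : ℕ} (hshort : ∀ k ∈ (range 7).erase i, b 0 - 2 * b (k + 1) < p)
    (h3 : nbig b p ≤ 3) (hd : dOf b < 2 * (p : ℤ)) (hcas : casoratian b j ≠ 0) :
    -eDflat b p - padicValRat p (rhoB (permLower σ b)) ≤ padicValRat p (casoratian b j) := by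
  refine flatGaugeLaw_of_cap b σ hb hj1 hj7 hb' hp hp5 hshort ?_ hcas
  rw [if_neg (not_le.2 hd), add_zero]
  exact_mod_cast h3

/-! ### Typed nodes (PROVED), gen-7's window law below them, the conjecture node above them -/

/-- **The flat `S₇`-gauge law on the capacity region** — `FlatGaugeLaw` with `m₁ < p²` replaced by: at most one long
block `b₀ − 2b_{k+1} ≥ p` (`k ≠ i`) and `#{k : b_{k+1} ≥ p} + [2p ≤ d] ≤ 3`.  PROVED: `flatGaugeLawCap_holds`. -/
def FlatGaugeLawCap : Prop :=
  ∀ (b : ℕ → ℤ) (j p i : ℕ) (σ : Equiv.Perm (Fin 7)), InPolytope b → 1 ≤ j → j ≤ 7 → InPolytope (shift b j) →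
    p.Prime → 5 ≤ p → (∀ k ∈ (range 7).erase i, b 0 - 2 * b (k + 1) < p) →
    (nbig b p : ℤ) + (if 2 * (p : ℤ) ≤ dOf b then 1 else 0) ≤ 3 → casoratian b j ≠ 0 →
    -eDflat b p - padicValRat p (rhoB (permLower σ b)) ≤ padicValRat p (casoratian b j)

/-- **The capacity law HOLDS** (= `flatGaugeLaw_of_cap`). -/
theorem flatGaugeLawCap_holds : FlatGaugeLawCap :=
  fun b _ _ _ σ hb hj1 hj7 hb' hp hp5 hshort hcap hcas =>
    flatGaugeLaw_of_cap b σ hb hj1 hj7 hb' hp hp5 hshort hcap hcas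

/-- **The flat `S₇`-gauge law on the disjoint region** — at most one long block, `b₀ < 3p`, `d < 2p`, and no lower
parameter `≥ p` a partner in a pair form `≥ p`.  PROVED: `flatGaugeLawDisj_holds`. -/
def FlatGaugeLawDisj : Prop :=
  ∀ (b : ℕ → ℤ) (j p i : ℕ) (σ : Equiv.Perm (Fin 7)), InPolytope b → 1 ≤ j → j ≤ 7 → InPolytope (shift b j) →
    p.Prime → 5 ≤ p → (∀ k ∈ (range 7).erase i, b 0 - 2 * b (k + 1) < p) → b 0 < 3 * (p : ℤ) →
    dOf b < 2 * (p : ℤ) →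
    (∀ j' ∈ range 7, ∀ k ∈ range 7, j' ≠ k → (p : ℤ) ≤ b (k + 1) → b 0 - b (j' + 1) - b (k + 1) < p) →
    casoratian b j ≠ 0 → -eDflat b p - padicValRat p (rhoB (permLower σ b)) ≤ padicValRat p (casoratian b j)

/-- **The disjoint law HOLDS** (= `flatGaugeLaw_of_disjoint`). -/
theorem flatGaugeLawDisj_holds : FlatGaugeLawDisj :=
  fun b _ _ _ σ hb hj1 hj7 hb' hp hp5 hshort hb3 hd hdisj hcas =>
    flatGaugeLaw_of_disjoint b σ hb hj1 hj7 hb' hp hp5 hshort hb3 hd hdisj hcas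

/-- Gen-7's window law is the case `nbig = 0` of the capacity law (all lower parameters `< p` ⇒ `nbig = 0 ≤ 2`). -/
theorem flatGaugeLawWindow_of_cap (h : FlatGaugeLawCap) : FlatGaugeLawWindow := by
  intro b j p i σ hb hj1 hj7 hb' hp hp5 _ hshort hsmall hcas
  refine h b j p i σ hb hj1 hj7 hb' hp hp5 hshort ?_ hcas
  rw [nbig_eq_zero_of_small hsmall]
  split_ifs <;> norm_num

/-- The trivial edge `FlatGaugeLaw ⇒ FlatGaugeLawCap` (`m₁ ≤ b₀ + 1 < p²` since `b₀ < 3p`). -/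
theorem flatGaugeLawCap_of_flatGaugeLaw (h : FlatGaugeLaw) : FlatGaugeLawCap := by
  intro b j p i σ hb hj1 hj7 hb' hp hp5 hshort hcap hcas
  have hind : (0 : ℤ) ≤ (if 2 * (p : ℤ) ≤ dOf b then 1 else 0) := by split_ifs <;> norm_num
  have h5 : nbig b p ≤ 5 := by exact_mod_cast (show (nbig b p : ℤ) ≤ 5 by linarith)
  have hwin := win_of_lt_three_p hp5 (b0_lt_three_p hshort h5)
  exact h b j p σ hb hj1 hj7 hb' hp hp5 (by have := Window.m1_le_b0_add_one hb; linarith) hcas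

/-- The trivial edge `FlatGaugeLaw ⇒ FlatGaugeLawDisj`. -/
theorem flatGaugeLawDisj_of_flatGaugeLaw (h : FlatGaugeLaw) : FlatGaugeLawDisj := by
  intro b j p i σ hb hj1 hj7 hb' hp hp5 _ hb3 _ _ hcas
  have hwin := win_of_lt_three_p hp5 hb3
  exact h b j p σ hb hj1 hj7 hb' hp hp5 (by have := Window.m1_le_b0_add_one hb; linarith) hcas

/-! ### Kernel instances -/

/-- (CAP) on an unbalanced direction: `b = 2·(20;10,9,6,6,6,6,1) = (40;20,18,12,12,12,12,2)` at `p = 17, 19`: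
`nbig = 2` resp. `1` (gen-7's window needs `p > 20`, gen-6's `p > m₁ = 26`), blocks `0,4,16,16,16,16,36` (one `≥ p`),
`d = 32 < 2p`. -/
example :
    let b : ℕ → ℤ := fun k => (([40, 20, 18, 12, 12, 12, 12, 2] : List ℤ)).getD k 0
    nbig b 17 = 2 ∧ nbig b 19 = 1 ∧ dOf b = 32 ∧ m1 b = 26 ∧
      ((List.range 7).map fun k => b 0 - 2 * b (k + 1)) = [0, 4, 16, 16, 16, 16, 36] := by
  decide

/-- (DISJ) beyond (CAP): `b = (10;5,5,5,5,4,4,1)`, `p = 5`: FOUR lower parameters `≥ p` (so (CAP) fails), the two pair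
forms `≥ p` are `10 − 1 − 4 = 5` (partners `4 < p`), every pair form through a `5` is `≤ 4`; blocks `0,0,0,0,2,2,8` (one
`≥ p`), `d = 1`, `b₀ = 10 < 15`.  And the extreme case `b = (12;5,5,5,5,5,5,5)`, `p = 5`: all SEVEN `b_k ≥ p`, no pair
form `≥ p` at all. -/
example :
    let b : ℕ → ℤ := fun k => (([10, 5, 5, 5, 5, 4, 4, 1] : List ℤ)).getD k 0
    let b' : ℕ → ℤ := fun k => (([12, 5, 5, 5, 5, 5, 5, 5] : List ℤ)).getD k 0
    nbig b 5 = 4 ∧ dOf b = 1 ∧ ((List.range 7).map fun k => b 0 - 2 * b (k + 1)) = [0, 0, 0, 0, 2, 2, 8] ∧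
      (∀ j' ∈ range 7, ∀ k ∈ range 7, j' ≠ k → (5 : ℤ) ≤ b (k + 1) → b 0 - b (j' + 1) - b (k + 1) < 5) ∧
      nbig b' 5 = 7 ∧ dOf b' = 1 ∧
      (∀ j' ∈ range 7, ∀ k ∈ range 7, j' ≠ k → (5 : ℤ) ≤ b' (k + 1) → b' 0 - b' (j' + 1) - b' (k + 1) < 5) := by
  decide

end Summit.KontsevichZagierPeriods.Zeta5Search.RVFlatGauge
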